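import Summits.Ventures.QEC.Census.BB.BB288.CoverL21D00
import Summits.Ventures.QEC.Census.BB.BB288.CoverL21D01
import Summits.Ventures.QEC.Census.BB.BB288.CoverL21D02
import Summits.Ventures.QEC.Census.BB.BB288.CoverL21D03
import Summits.Ventures.QEC.Census.BB.BB288.CoverL21D04
import Summits.Ventures.QEC.Census.BB.BB288.CoverL21D05
import Summits.Ventures.QEC.Census.BB.BB288.CoverL21D06
import Summits.Ventures.QEC.Census.BB.BB288.CoverReps
import Summits.Ventures.QEC.Census.CertCoverProducers
import HarnessLib

set_option Elab.async false

/-!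
# `[[288,12,18]]` cover certificate — LEVEL 2→1 PROBLEM LIST `qlist` (the 273 coset problems in `reps2` order), the candidate family `cand2 j := listGen cov2 qlist[j] reps2[j]` of T2 `cov_of_levels`, their union `cand1`, and the membership adapter `hsub1` (= `hsub` of T2)
(qec-search-9 g4 LINK module per qec-type-10 COVER-ASSEMBLY-TEMPLATE v1.0 §1/§2; generated by work/links/gen_links.py.)
-/

namespace Summit.Ventures.QEC.Census.BB288Cover

open Summit.Ventures.QEC.Census

/-- The 273 level-2→1 coset problems, in the order of `reps2` (DATA index). -/
def qlist : List CosetProb :=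
  [q0, q1, q2, q3, q4, q5, q6, q7, q8, q9, q10, q11, q12, q13, q14, q15, q16, q17, q18, q19, q20, q21, q22, q23, q24, q25, q26, q27, q28, q29, q30, q31, q32, q33, q34, q35, q36, q37, q38, q39, q40, q41, q42, q43, q44, q45, q46, q47, q48, q49, q50, q51, q52, q53, q54, q55, q56, q57, q58, q59, q60, q61, q62, q63, q64, q65, q66, q67, q68, q69, q70, q71, q72, q73, q74, q75, q76, q77, q78, q79, q80, q81, q82, q83, q84, q85, q86, q87, q88, q89, q90, q91, q92, q93, q94, q95, q96, q97, q98, q99, q100, q101, q102, q103, q104, q105, q106, q107, q108, q109, q110, q111, q112, q113, q114, q115, q116, q117, q118, q119, q120, q121, q122, q123, q124, q125, q126, q127, q128, q129, q130, q131, q132, q133, q134, q135, q136, q137, q138, q139, q140, q141, q142, q143, q144, q145, q146, q147, q148, q149, q150, q151, q152, q153, q154, q155, q156, q157, q158, q159, q160, q161, q162, q163, q164, q165, q166, q167, q168, q169, q170, q171, q172, q173, q174, q175, q176, q177, q178, q179, q180, q181, q182, q183, q184, q185, q186, q187, q188, q189, q190, q191, q192, q193, q194, q195, q196, q197, q198,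 q199, q200, q201, q202, q203, q204, q205, q206, q207, q208, q209, q210, q211, q212, q213, q214, q215, q216, q217, q218, q219, q220, q221, q222, q223, q224, q225, q226, q227, q228, q229, q230, q231, q232, q233, q234, q235, q236, q237, q238, q239, q240, q241, q242, q243, q244, q245, q246, q247, q248, q249, q250, q251, q252, q253, q254, q255, q256, q257, q258, q259, q260, q261, q262, q263, q264, q265, q266, q267, q268, q269, q270, q271, q272]

/-- `qlist` has 273 entries. -/
theorem qlist_length : qlist.length = 273 := by decide +kernel

/-- `reps2` has 273 entries. -/
theorem reps2_length : reps2.length = 273 := by decide +kernel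

/-- The candidate family of T2 `cov_of_levels`: the words generated by level-2→1 problem `j` over its representative. -/
def cand2 (j : ℕ) : List ℕ := listGen cov2 (qlist.getD j q0) (reps2.getD j 0)

/-- The union of all candidate lists (the `cand` of T1′/T2). -/
def cand1 : List ℕ := (List.range 273).flatMap cand2

/-- **hsub** of T2: every per-problem candidate is in the union. -/
theorem hsub1 : ∀ j : ℕ, j < reps2.length → ∀ u ∈ cand2 j, u ∈ cand1 := by
  intro j hj
  rw [reps2_length] at hj
  exact mem_flatMap_range j hj

end Summit.Ventures.QEC.Census.BB288Cover
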